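import Mathlib.RingTheory.Smooth.StandardSmoothCotangent
import Mathlib.RingTheory.Extension.Presentation.Submersive
import Mathlib.RingTheory.Etale.Basic
import Mathlib.RingTheory.RingHom.Etale
import Mathlib.RingTheory.Derivation.Basic
import Mathlib.Algebra.MvPolynomial.PDeriv
import Mathlib.LinearAlgebra.Matrix.Block
import Mathlib.FieldTheory.Separable
import Mathlib.FieldTheory.Minpoly.Field
import HarnessLib

/-!
# Étale coordinates vanishing at a point with separable residue field

Topic: `Literature/AlgebraicGeometry/Resolution`. A technical step of the algebraic proof of
Temkin's decompletion lemma (M. Temkin, *Inseparable local uniformization*, J. Algebra 373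
(2013) 65–119 = arXiv:0804.1554v3, Lemma 3.3.2: "Let `T = (T₁, …, T_n)` be a system of regular
parameters of `𝒪_{𝔛_η,x̂}`. The morphism `U → 𝐀ⁿ_k̂`, which `T` induces on a sufficiently small
affinoid neighborhood of `x̂`, is étale at `x̂`"; tree: `Temkin2013_Lemma332_nft`). Mathlib's
local structure theorem `Algebra.IsSmoothAt.exists_isStandardEtale_mvPolynomial` produces, for
a finitely presented algebra `S` smooth at a prime `x` over a field `k`, étale coordinates
`k[X₁, …, X_n] → S_f`, but the coordinates `T′ᵢ` (images of `Xᵢ`) need not VANISH at `x`: their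
values `tᵢ ∈ k(x)` are merely separable algebraic over `k`. This file replaces them by
`Tᵢ := pᵢ(T′ᵢ)` with `pᵢ` the minimal polynomial of `tᵢ` over `k`: then `Tᵢ(x) = 0`, and
`k[X] → S_{f·D}`, `Xᵢ ↦ Tᵢ`, is again étale, where `D = ∏ pᵢ′(T′ᵢ)` does not vanish at `x` by
separability.

* `diagRel k p`, `DiagRing k p` — for polynomials `p : Fin n → k[X]`, the
  `k[X₁, …, X_n]`-algebra `k[X][X′₁, …, X′_n, Y] / (pᵢ(X′ᵢ) − Xᵢ, Y·∏ pᵢ′(X′ᵢ) − 1)`; PROVED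
  standard smooth of relative dimension `0` (upper triangular Jacobian with determinant
  `(∏ pᵢ′(X′ᵢ))²`, a unit), hence `Algebra.Etale` (The Stacks Project, Tag 00T7).
* `minpolyCoord`, `minpolyCoordDen` and `etale_aeval_minpolyCoord` — for an étale
  `k[X₁, …, X_n]`-algebra `S₀` (coordinates `T′ᵢ`) and separable elements `tᵢ` of a field
  extension of `k`: the map `k[X] → S₀[1/D]`, `Xᵢ ↦ pᵢ(T′ᵢ)` (`pᵢ = minpoly k tᵢ`,
  `D = ∏ pᵢ′(T′ᵢ)`), is étale (`RingHom.Etale`) — PROVED; with the evaluation facts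
  `minpolyCoord` `↦ 0` and `minpolyCoordDen` `↦` non-zero under any `k`-algebra map sending
  `T′ᵢ ↦ tᵢ`.

All statements are [folklore]; no named facts.

## Sources

* The Stacks Project, Tag 00T7 (standard smooth presentations), Tag 00U0–00U9 (étale maps).
* M. Temkin, arXiv:0804.1554v3, proof of Lemma 3.3.2 (the application).
-/

noncomputable section

open MvPolynomial Polynomial

namespace Literature.AlgebraicGeometry.Resolution

universe u v

section DiagonalChart

variable (k : Type u) [CommRing k] {n : ℕ} (p : Fin n → k[X])

/-- The polynomial `pᵢ` with coefficients pushed into `k[X₁, …, X_n]`. [folklore] -/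
def diagPoly (i : Fin n) : (MvPolynomial (Fin n) k)[X] :=
  (p i).map (algebraMap k (MvPolynomial (Fin n) k))

/-- `pᵢ′(X′ᵢ)` as a polynomial in the chart variables `X′₁, …, X′_n, Y` over `k[X]`. [folklore] -/
def diagDerivAt (i : Fin n) : MvPolynomial (Fin (n + 1)) (MvPolynomial (Fin n) k) :=
  Polynomial.aeval (MvPolynomial.X i.castSucc) (derivative (diagPoly k p i))

/-- `D = ∏ᵢ pᵢ′(X′ᵢ)`. [folklore] -/
def diagDen : MvPolynomial (Fin (n + 1)) (MvPolynomial (Fin n) k) :=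
  ∏ i : Fin n, diagDerivAt k p i

/-- The relations of the diagonal chart: `pᵢ(X′ᵢ) − Xᵢ` for `i < n` (index `i.castSucc`) and
`Y·D − 1` (index `Fin.last n`), in the variables `X′ᵢ = X (i.castSucc)`, `Y = X (Fin.last n)`
over `k[X₁, …, X_n]`. [folklore] -/
def diagRel : Fin (n + 1) → MvPolynomial (Fin (n + 1)) (MvPolynomial (Fin n) k) :=
  Fin.lastCases (MvPolynomial.X (Fin.last n) * diagDen k p - 1)
    (fun i => Polynomial.aeval (MvPolynomial.X i.castSucc) (diagPoly k p i) -
      MvPolynomial.C (MvPolynomial.X i))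

/-- The last relation is `Y·D − 1`. [folklore] -/
@[simp] theorem diagRel_last :
    diagRel k p (Fin.last n) = MvPolynomial.X (Fin.last n) * diagDen k p - 1 := by
  simp [diagRel]

/-- The `i`-th relation is `pᵢ(X′ᵢ) − Xᵢ`. [folklore] -/
@[simp] theorem diagRel_castSucc (i : Fin n) :
    diagRel k p i.castSucc = Polynomial.aeval (MvPolynomial.X i.castSucc) (diagPoly k p i) -
      MvPolynomial.C (MvPolynomial.X i) := by
  simp [diagRel]

/-- The diagonal chart `k[X][X′, Y] / (pᵢ(X′ᵢ) − Xᵢ, Y·D − 1)` (reducible: it is literally the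
quotient ring, with its quotient `k[X]`-algebra structure). [folklore] -/
abbrev DiagRing : Type u :=
  MvPolynomial (Fin (n + 1)) (MvPolynomial (Fin n) k) ⧸ Ideal.span (Set.range (diagRel k p))

/-- The quotient map onto the diagonal chart. [folklore] -/
def DiagRing.proj : MvPolynomial (Fin (n + 1)) (MvPolynomial (Fin n) k) →ₐ[MvPolynomial (Fin n) k]
    DiagRing k p :=
  Ideal.Quotient.mkₐ _ _

/-- `proj` is `Ideal.Quotient.mk`. [folklore] -/
theorem DiagRing.proj_apply (q : MvPolynomial (Fin (n + 1)) (MvPolynomial (Fin n) k)) :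
    DiagRing.proj k p q = Ideal.Quotient.mk (Ideal.span (Set.range (diagRel k p))) q := rfl

/-- The relations vanish in the chart. [folklore] -/
theorem DiagRing.proj_diagRel (i : Fin (n + 1)) : DiagRing.proj k p (diagRel k p i) = 0 := by
  rw [DiagRing.proj_apply]
  exact Ideal.Quotient.eq_zero_iff_mem.mpr (Ideal.subset_span ⟨i, rfl⟩)

/-- `Y·D = 1` in the chart. [folklore] -/
theorem DiagRing.proj_X_last_mul_diagDen :
    DiagRing.proj k p (MvPolynomial.X (Fin.last n)) * DiagRing.proj k p (diagDen k p) = 1 := by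
  rw [← map_mul, ← map_one (DiagRing.proj k p), ← sub_eq_zero, ← map_sub, ← diagRel_last]
  exact DiagRing.proj_diagRel k p _

/-- `D` is a unit in the chart. [folklore] -/
theorem DiagRing.isUnit_proj_diagDen : IsUnit (DiagRing.proj k p (diagDen k p)) := by
  have h1 := DiagRing.proj_X_last_mul_diagDen k p
  have h2 : DiagRing.proj k p (diagDen k p) * DiagRing.proj k p (MvPolynomial.X (Fin.last n)) = 1 := by
    rw [← map_mul, mul_comm, map_mul]; exact h1
  exact ⟨⟨_, _, h2, h1⟩, rfl⟩

/-! #### The Jacobian -/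

/-- `∂/∂X_i` of `q(X′_j)` is `q′(X′_j)` if `i = j.castSucc` and `0` otherwise. [folklore] -/
theorem pderiv_aeval_X (i : Fin (n + 1)) (j : Fin (n + 1))
    (q : (MvPolynomial (Fin n) k)[X]) :
    pderiv i (Polynomial.aeval (MvPolynomial.X j :
        MvPolynomial (Fin (n + 1)) (MvPolynomial (Fin n) k)) q) =
      if j = i then Polynomial.aeval (MvPolynomial.X j) (derivative q) else 0 := by
  classical
  rw [Derivation.map_aeval, pderiv_X, smul_eq_mul]
  by_cases h : j = i
  · subst h; simp
  · simp [h]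

/-- `∂D/∂Y = 0`. [folklore] -/
theorem pderiv_last_diagDen : pderiv (Fin.last n) (diagDen k p) = 0 := by
  classical
  unfold diagDen
  induction (Finset.univ : Finset (Fin n)) using Finset.induction_on with
  | empty => simp
  | insert a s ha ih =>
    rw [Finset.prod_insert ha, Derivation.leibniz, ih, smul_zero, zero_add, diagDerivAt,
      pderiv_aeval_X, if_neg (Fin.castSucc_lt_last a).ne, smul_zero]

/-- The Jacobi matrix of the naive presentation of the chart is upper triangular.
[folklore] -/
theorem pderiv_diagRel_eq_zero {i j : Fin (n + 1)} (hji : j < i) :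
    pderiv i (diagRel k p j) = 0 := by
  -- `j < i ≤ last`, so `j = j₀.castSucc`
  obtain ⟨j₀, rfl⟩ : ∃ j₀ : Fin n, j₀.castSucc = j :=
    ⟨j.castPred (Fin.ne_last_of_lt hji), Fin.castSucc_castPred _ _⟩
  rw [diagRel_castSucc, map_sub, pderiv_C, sub_zero, pderiv_aeval_X, if_neg hji.ne]

/-- Diagonal entries, `i < n`: `∂(pᵢ(X′ᵢ) − Xᵢ)/∂X′ᵢ = pᵢ′(X′ᵢ)`. [folklore] -/
theorem pderiv_diagRel_castSucc_self (i : Fin n) :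
    pderiv i.castSucc (diagRel k p i.castSucc) = diagDerivAt k p i := by
  rw [diagRel_castSucc, map_sub, pderiv_C, sub_zero, pderiv_aeval_X, if_pos rfl]
  rfl

/-- Diagonal entry at `Y`: `∂(Y·D − 1)/∂Y = D`. [folklore] -/
theorem pderiv_diagRel_last_self :
    pderiv (Fin.last n) (diagRel k p (Fin.last n)) = diagDen k p := by
  rw [diagRel_last, map_sub, pderiv_one, sub_zero, Derivation.leibniz, pderiv_last_diagDen,
    smul_zero, zero_add, pderiv_X_self, smul_eq_mul, mul_one]

/-- The naive pre-submersive presentation of the chart (all `n + 1` variables are relation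
variables: relative dimension `0`). [folklore] -/
def diagPre : Algebra.PreSubmersivePresentation (MvPolynomial (Fin n) k) (DiagRing k p)
    (Fin (n + 1)) (Fin (n + 1)) :=
  Algebra.PreSubmersivePresentation.naive (v := diagRel k p) id Function.injective_id

/-- The Jacobian determinant of the chart is `D·D`. [folklore] -/
theorem det_jacobiMatrix_diagPre :
    (diagPre k p).jacobiMatrix.det = diagDen k p * diagDen k p := by
  classical
  have hupper : (diagPre k p).jacobiMatrix.BlockTriangular id := by
    intro i j hji
    rw [diagPre, Algebra.PreSubmersivePresentation.jacobiMatrix_naive]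
    exact pderiv_diagRel_eq_zero k p hji
  rw [Matrix.det_of_upperTriangular hupper, Fin.prod_univ_castSucc]
  congr 1
  · refine Finset.prod_congr rfl fun i _ => ?_
    rw [diagPre, Algebra.PreSubmersivePresentation.jacobiMatrix_naive]
    exact pderiv_diagRel_castSucc_self k p i
  · rw [diagPre, Algebra.PreSubmersivePresentation.jacobiMatrix_naive]
    exact pderiv_diagRel_last_self k p

/-- The structure map of the naive presentation is the quotient map. [folklore] -/
theorem algebraMap_diagPre_ring (q : MvPolynomial (Fin (n + 1)) (MvPolynomial (Fin n) k)) :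
    algebraMap (diagPre k p).Ring (DiagRing k p) q = DiagRing.proj k p q := by
  rw [(diagPre k p).algebraMap_apply]
  have : MvPolynomial.aeval (R := MvPolynomial (Fin n) k) (diagPre k p).val =
      DiagRing.proj k p := by
    refine MvPolynomial.algHom_ext fun i => ?_
    rw [MvPolynomial.aeval_X]
    rfl
  exact congr($this q)

/-- The submersive presentation of the chart: its Jacobian `D²` is a unit. [folklore] -/
def diagSubmersive : Algebra.SubmersivePresentation (MvPolynomial (Fin n) k) (DiagRing k p)
    (Fin (n + 1)) (Fin (n + 1)) where
  __ := diagPre k p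
  jacobian_isUnit := by
    classical
    rw [Algebra.PreSubmersivePresentation.jacobian_eq_jacobiMatrix_det, det_jacobiMatrix_diagPre,
      algebraMap_diagPre_ring, map_mul]
    exact (DiagRing.isUnit_proj_diagDen k p).mul (DiagRing.isUnit_proj_diagDen k p)

/-- The chart is standard smooth of relative dimension `0` over `k[X₁, …, X_n]`. [folklore] -/
instance DiagRing.isStandardSmoothOfRelativeDimension_zero :
    Algebra.IsStandardSmoothOfRelativeDimension 0 (MvPolynomial (Fin n) k) (DiagRing k p) :=
  (diagSubmersive k p).isStandardSmoothOfRelativeDimension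
    (by simp [Algebra.Presentation.dimension])

/-- Hence the chart is étale over `k[X₁, …, X_n]` (Stacks Project, Tag 00T7). [folklore] -/
instance DiagRing.etale : Algebra.Etale (MvPolynomial (Fin n) k) (DiagRing k p) := inferInstance

end DiagonalChart

/-! ### The quotient `k[X′][1/D₀] → DiagRing` is surjective -/

section BaseChangeOfCoordinates

variable (k : Type u) [CommRing k] {n : ℕ} (p : Fin n → k[X])

/-- `D₀ = ∏ pᵢ′(Xᵢ) ∈ k[X₁, …, X_n]` (the Jacobian of `Xᵢ ↦ pᵢ(Xᵢ)`). [folklore] -/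
def diagDen₀ : MvPolynomial (Fin n) k :=
  ∏ i : Fin n, Polynomial.aeval (MvPolynomial.X i : MvPolynomial (Fin n) k) (derivative (p i))

/-- The "old coordinates" map `u : k[X′₁, …, X′_n] → DiagRing`, `X′ᵢ ↦ class of X′ᵢ`.
[folklore] -/
def diagOld : MvPolynomial (Fin n) k →+* DiagRing k p :=
  MvPolynomial.eval₂Hom (algebraMap k (DiagRing k p))
    (fun i => DiagRing.proj k p (MvPolynomial.X i.castSucc))

/-- `u(X′ᵢ)` is the class of `X′ᵢ`. [folklore] -/
@[simp] theorem diagOld_X (i : Fin n) :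
    diagOld k p (MvPolynomial.X i) = DiagRing.proj k p (MvPolynomial.X i.castSucc) := by
  simp [diagOld]

/-- `u` on constants. [folklore] -/
@[simp] theorem diagOld_C (c : k) :
    diagOld k p (MvPolynomial.C c) = algebraMap k (DiagRing k p) c := by
  simp [diagOld]

/-- `u` is a `k`-algebra map. [folklore] -/
def diagOldₐ : MvPolynomial (Fin n) k →ₐ[k] DiagRing k p :=
  { diagOld k p with commutes' := fun c => by simp [diagOld] }

/-- `diagOldₐ` is `diagOld`. [folklore] -/
@[simp] theorem diagOldₐ_apply (q : MvPolynomial (Fin n) k) : diagOldₐ k p q = diagOld k p q := rfl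

/-- `u(q(Xᵢ)) = class of q(X′ᵢ)` for a univariate `q` over `k`. [folklore] -/
theorem diagOld_aeval_X (i : Fin n) (q : k[X]) :
    diagOld k p (Polynomial.aeval (MvPolynomial.X i : MvPolynomial (Fin n) k) q) =
      DiagRing.proj k p (Polynomial.aeval (MvPolynomial.X i.castSucc)
        (q.map (algebraMap k (MvPolynomial (Fin n) k)))) := by
  rw [← diagOldₐ_apply, ← Polynomial.aeval_algHom_apply, diagOldₐ_apply, diagOld_X,
    Polynomial.aeval_map_algebraMap]
  change _ = ((DiagRing.proj k p).restrictScalars k) _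
  rw [← Polynomial.aeval_algHom_apply]
  rfl

/-- `u(D₀) = class of D`. [folklore] -/
theorem diagOld_diagDen₀ : diagOld k p (diagDen₀ k p) = DiagRing.proj k p (diagDen k p) := by
  simp only [diagDen₀, map_prod, diagDen, diagDerivAt, diagPoly, Polynomial.derivative_map]
  exact Finset.prod_congr rfl fun i _ => diagOld_aeval_X k p i _

/-- `u(pᵢ(Xᵢ)) = class of Xᵢ` (from the relation `pᵢ(X′ᵢ) − Xᵢ`). [folklore] -/
theorem diagOld_aeval_p (i : Fin n) :
    diagOld k p (Polynomial.aeval (MvPolynomial.X i : MvPolynomial (Fin n) k) (p i)) =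
      DiagRing.proj k p (MvPolynomial.C (MvPolynomial.X i)) := by
  have h := DiagRing.proj_diagRel k p i.castSucc
  rw [diagRel_castSucc, map_sub, sub_eq_zero] at h
  rw [diagOld_aeval_X]
  exact h

/-- `u(D₀)` is a unit. [folklore] -/
theorem isUnit_diagOld_diagDen₀ : IsUnit (diagOld k p (diagDen₀ k p)) := by
  rw [diagOld_diagDen₀]; exact DiagRing.isUnit_proj_diagDen k p

/-- The induced map `ū : k[X′][1/D₀] → DiagRing`. [folklore] -/
def diagOldAway : Localization.Away (diagDen₀ k p) →+* DiagRing k p :=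
  IsLocalization.Away.lift (diagDen₀ k p) (isUnit_diagOld_diagDen₀ k p)

/-- `ū` extends `u`. [folklore] -/
theorem diagOldAway_algebraMap (q : MvPolynomial (Fin n) k) :
    diagOldAway k p (algebraMap _ _ q) = diagOld k p q :=
  IsLocalization.Away.lift_eq (diagDen₀ k p) _ q

/-- The image of `u` together with the inverse of `D` generates `DiagRing`: the induced map
`ū : k[X′][1/D₀] → DiagRing` is surjective. [folklore] -/
theorem diagOldAway_surjective : Function.Surjective (diagOldAway k p) := by
  set ū := diagOldAway k p
  let ι : MvPolynomial (Fin n) k →+* Localization.Away (diagDen₀ k p) := algebraMap _ _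
  have hū : ∀ q, ū (ι q) = diagOld k p q := diagOldAway_algebraMap k p
  -- the range of `ū` is a subring containing all generators
  suffices h : ∀ q : MvPolynomial (Fin (n + 1)) (MvPolynomial (Fin n) k),
      DiagRing.proj k p q ∈ ū.range by
    intro z
    obtain ⟨q, rfl⟩ := Ideal.Quotient.mk_surjective z
    exact h q
  intro q
  induction q using MvPolynomial.induction_on with
  | C b =>
    -- constants from `k[X]`: by induction on `b`
    induction b using MvPolynomial.induction_on with
    | C c =>
      refine ⟨ι (MvPolynomial.C c), ?_⟩
      rw [hū, diagOld_C]
      rfl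
    | add f g hf hg =>
      rw [map_add, map_add]
      exact add_mem hf hg
    | mul_X f i hf =>
      rw [map_mul, map_mul]
      refine mul_mem hf ⟨ι (Polynomial.aeval (MvPolynomial.X i) (p i)), ?_⟩
      rw [hū, diagOld_aeval_p]
  | add f g hf hg =>
    rw [map_add]
    exact add_mem hf hg
  | mul_X f i hf =>
    rw [map_mul]
    refine mul_mem hf ?_
    refine Fin.lastCases ?_ (fun i => ?_) i
    · -- `Y` is the inverse of `D = ū(D₀)`
      have hunit : IsUnit (ι (diagDen₀ k p)) := IsLocalization.Away.algebraMap_isUnit _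
      refine ⟨↑(hunit.unit⁻¹), ?_⟩
      have h1 : ū ↑(hunit.unit⁻¹) * DiagRing.proj k p (diagDen k p) = 1 := by
        rw [← diagOld_diagDen₀, ← hū, ← map_mul, IsUnit.val_inv_mul, map_one]
      calc ū ↑(hunit.unit⁻¹)
          = ū ↑(hunit.unit⁻¹) * (DiagRing.proj k p (diagDen k p) *
              DiagRing.proj k p (MvPolynomial.X (Fin.last n))) := by
            rw [mul_comm (DiagRing.proj k p (diagDen k p)), DiagRing.proj_X_last_mul_diagDen,
              mul_one]
        _ = DiagRing.proj k p (MvPolynomial.X (Fin.last n)) := by rw [← mul_assoc, h1, one_mul]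
    · exact ⟨ι (MvPolynomial.X i), by rw [hū, diagOld_X]⟩

/-- Hence `u : k[X′] → DiagRing` is formally unramified. [folklore] -/
theorem formallyUnramified_diagOld :
    RingHom.FormallyUnramified (R := MvPolynomial (Fin n) k) (S := DiagRing k p) (diagOld k p) := by
  have hcomp : diagOld k p = (diagOldAway k p).comp
      (algebraMap (MvPolynomial (Fin n) k) (Localization.Away (diagDen₀ k p))) :=
    (IsLocalization.Away.lift_comp (diagDen₀ k p) (isUnit_diagOld_diagDen₀ k p)).symm
  rw [hcomp]
  refine RingHom.FormallyUnramified.comp ?_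
    (RingHom.FormallyUnramified.of_surjective (diagOldAway_surjective k p))
  exact RingHom.formallyUnramified_algebraMap.mpr inferInstance

end BaseChangeOfCoordinates

/-! ### Application: étale coordinates `pᵢ(T′ᵢ)` -/

section Application

variable (k : Type u) [Field k] {n : ℕ} {S₀ : Type v} [CommRing S₀]
  [Algebra (MvPolynomial (Fin n) k) S₀]
  {m : Type*} [Field m] [Algebra k m] (t : Fin n → m)

/-- The new coordinate `Tᵢ = pᵢ(T′ᵢ)`, `pᵢ = minpoly k tᵢ`, `T′ᵢ` the given coordinate.
[folklore] -/
def minpolyCoord (i : Fin n) : S₀ :=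
  algebraMap (MvPolynomial (Fin n) k) S₀ (Polynomial.aeval (MvPolynomial.X i) (minpoly k (t i)))

/-- The denominator `D = ∏ pᵢ′(T′ᵢ)`. [folklore] -/
def minpolyCoordDen : S₀ :=
  algebraMap (MvPolynomial (Fin n) k) S₀ (diagDen₀ k (fun i => minpoly k (t i)))

/-- Under a `k[X′]`-algebra map `φ₀ : S₀ → m` with `T′ᵢ ↦ tᵢ`, the new coordinates vanish:
`φ₀(Tᵢ) = pᵢ(tᵢ) = 0`. [folklore] -/
theorem eval_minpolyCoord (φ₀ : S₀ →+* m)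
    (hφ : ∀ q, φ₀ (algebraMap (MvPolynomial (Fin n) k) S₀ q) = MvPolynomial.aeval (R := k) t q)
    (i : Fin n) : φ₀ (minpolyCoord k t i) = 0 := by
  rw [minpolyCoord, hφ, ← Polynomial.aeval_algHom_apply, MvPolynomial.aeval_X, minpoly.aeval]

/-- … and the denominator does not: `φ₀(D) = ∏ pᵢ′(tᵢ) ≠ 0` when the `tᵢ` are separable over
`k`. [folklore] -/
theorem eval_minpolyCoordDen_ne_zero (φ₀ : S₀ →+* m)
    (hφ : ∀ q, φ₀ (algebraMap (MvPolynomial (Fin n) k) S₀ q) = MvPolynomial.aeval (R := k) t q)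
    (hsep : ∀ i, IsSeparable k (t i)) : φ₀ (minpolyCoordDen k t) ≠ 0 := by
  rw [minpolyCoordDen, hφ, diagDen₀, map_prod, Finset.prod_ne_zero_iff]
  intro i _
  rw [← Polynomial.aeval_algHom_apply, MvPolynomial.aeval_X]
  exact Polynomial.Separable.aeval_derivative_ne_zero (hsep i) (minpoly.aeval k (t i))

variable [Algebra k S₀]

/-- The new structure map `ψ : k[X₁, …, X_n] → S₀[1/D]`, `Xᵢ ↦ Tᵢ = pᵢ(T′ᵢ)`, as a
`k`-algebra map. [folklore] -/
def minpolyCoordMapₐ :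
    MvPolynomial (Fin n) k →ₐ[k] Localization.Away (minpolyCoordDen (S₀ := S₀) k t) :=
  MvPolynomial.aeval (R := k)
    (fun i => algebraMap S₀ (Localization.Away (minpolyCoordDen (S₀ := S₀) k t))
      (minpolyCoord k t i))

/-- The new structure map `ψ : k[X₁, …, X_n] → S₀[1/D]`, `Xᵢ ↦ Tᵢ = pᵢ(T′ᵢ)`. [folklore] -/
def minpolyCoordMap : MvPolynomial (Fin n) k →+* Localization.Away (minpolyCoordDen (S₀ := S₀) k t) :=
  (minpolyCoordMapₐ (S₀ := S₀) k t).toRingHom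

/-- `ψ(Xᵢ) = Tᵢ`. [folklore] -/
@[simp] theorem minpolyCoordMap_X (i : Fin n) :
    minpolyCoordMap k t (MvPolynomial.X i) =
      algebraMap S₀ (Localization.Away (minpolyCoordDen (S₀ := S₀) k t)) (minpolyCoord k t i) := by
  simp [minpolyCoordMap, minpolyCoordMapₐ]

/-- `ψ` on constants. [folklore] -/
@[simp] theorem minpolyCoordMap_C (c : k) :
    minpolyCoordMap (S₀ := S₀) k t (MvPolynomial.C c) =
      algebraMap k (Localization.Away (minpolyCoordDen (S₀ := S₀) k t)) c := by
  simp [minpolyCoordMap, minpolyCoordMapₐ]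

/-- **Étale coordinates vanishing at a point.** If `S₀` is étale over `k[X′₁, …, X′_n]` and
`tᵢ` are separable over `k`, then `k[X₁, …, X_n] → S₀[1/D]`, `Xᵢ ↦ pᵢ(T′ᵢ)` (`pᵢ` the minimal
polynomial of `tᵢ`, `D = ∏ pᵢ′(T′ᵢ)`), is étale. Proof: it factors as
`k[X] → DiagRing → S₀[1/D]`; the first map is étale (`DiagRing.etale`); the second is formally
étale because its precomposition with the formally unramified `k[X′] → DiagRing` is the formally
étale `k[X′] → S₀ → S₀[1/D]` (`RingHom.FormallyEtale.of_comp`), and everything is finitely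
presented over `k`. (Separability of the `tᵢ` is not needed for étaleness — only for `D` not to
vanish at the point, `eval_minpolyCoordDen_ne_zero`.) [folklore] -/
theorem etale_minpolyCoordMap [IsScalarTower k (MvPolynomial (Fin n) k) S₀]
    [Algebra.Etale (MvPolynomial (Fin n) k) S₀] :
    (minpolyCoordMap (S₀ := S₀) k t).Etale := by
  set p : Fin n → k[X] := fun i => minpoly k (t i) with hp
  -- notation
  let B := MvPolynomial (Fin n) k
  let S₁ := Localization.Away (minpolyCoordDen (S₀ := S₀) k t)
  let ψₐ : B →ₐ[k] S₁ := minpolyCoordMapₐ (S₀ := S₀) k t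
  have hψX : ∀ i, ψₐ (MvPolynomial.X i) = algebraMap S₀ S₁ (minpolyCoord k t i) := fun i =>
    MvPolynomial.aeval_X _ i
  -- the `k`-algebra map `k[X′] → S₁` (old structure)
  let ι₁ : B →ₐ[k] S₁ := IsScalarTower.toAlgHom k B S₁
  have hι₁ : ∀ q, ι₁ q = algebraMap B S₁ q := fun q => rfl
  -- the map `g₀ : k[X][X′, Y] → S₁`
  have hDunit : IsUnit (algebraMap S₀ S₁ (minpolyCoordDen k t)) :=
    IsLocalization.Away.algebraMap_isUnit _
  let vals : Fin (n + 1) → S₁ :=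
    Fin.lastCases (↑(hDunit.unit⁻¹)) (fun i => algebraMap B S₁ (MvPolynomial.X i))
  have hvals_last : vals (Fin.last n) = ↑(hDunit.unit⁻¹) := by simp [vals]
  have hvals_cs : ∀ i : Fin n, vals i.castSucc = algebraMap B S₁ (MvPolynomial.X i) := fun i => by
    simp [vals]
  let g₀ : MvPolynomial (Fin (n + 1)) B →ₐ[k] S₁ := MvPolynomial.aevalTower ψₐ vals
  have hg₀C : ∀ b : B, g₀ (MvPolynomial.C b) = ψₐ b := fun b => MvPolynomial.aevalTower_C _ _ _
  have hg₀X : ∀ i, g₀ (MvPolynomial.X i) = vals i := fun i => MvPolynomial.aevalTower_X _ _ _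
  -- `g₀` on `q(X′ᵢ)` for univariate `q` over `k`
  have hg₀aeval : ∀ (i : Fin n) (q : k[X]),
      g₀ (Polynomial.aeval (MvPolynomial.X i.castSucc) (q.map (algebraMap k B))) =
        algebraMap B S₁ (Polynomial.aeval (MvPolynomial.X i) q) := by
    intro i q
    rw [Polynomial.aeval_map_algebraMap, ← Polynomial.aeval_algHom_apply g₀, hg₀X, hvals_cs,
      ← hι₁, Polynomial.aeval_algHom_apply ι₁, hι₁]
  have hg₀den : g₀ (diagDen k p) = algebraMap S₀ S₁ (minpolyCoordDen k t) := by
    change g₀ (diagDen k p) = algebraMap S₀ S₁ (algebraMap B S₀ (diagDen₀ k p))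
    rw [← IsScalarTower.algebraMap_apply, diagDen₀, map_prod, diagDen, map_prod]
    refine Finset.prod_congr rfl fun i _ => ?_
    rw [diagDerivAt, diagPoly, Polynomial.derivative_map]
    exact hg₀aeval i _
  -- `g₀` kills the relations
  have hg₀rel : ∀ a ∈ Ideal.span (Set.range (diagRel k p)), g₀ a = 0 := by
    intro a ha
    refine Submodule.span_induction (p := fun a _ => g₀ a = 0) ?_ (map_zero _) ?_ ?_ ha
    · rintro _ ⟨i, rfl⟩
      refine Fin.lastCases ?_ (fun i => ?_) i
      · rw [diagRel_last, map_sub, map_one, map_mul, hg₀X, hvals_last, hg₀den,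
          IsUnit.val_inv_mul, sub_self]
      · rw [diagRel_castSucc, map_sub, diagPoly, hg₀aeval, hg₀C, hψX, minpolyCoord,
          ← IsScalarTower.algebraMap_apply, sub_self]
    · intro x y _ _ hx hy
      rw [map_add, hx, hy, add_zero]
    · intro c x _ hx
      rw [smul_eq_mul, map_mul, hx, mul_zero]
  let g : DiagRing k p →ₐ[k] S₁ := Ideal.Quotient.liftₐ _ g₀ hg₀rel
  have hg : ∀ q, g (DiagRing.proj k p q) = g₀ q := fun q => rfl
  -- `g ∘ u = (k[X′] → S₁)`
  have hgu : g.toRingHom.comp (diagOld k p) = algebraMap B S₁ := by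
    refine MvPolynomial.ringHom_ext (fun c => ?_) (fun i => ?_)
    · rw [RingHom.comp_apply, diagOld_C, AlgHom.toRingHom_eq_coe, AlgHom.coe_toRingHom,
        AlgHom.commutes, ← MvPolynomial.algebraMap_eq, ← IsScalarTower.algebraMap_apply]
    · rw [RingHom.comp_apply, diagOld_X, AlgHom.toRingHom_eq_coe, AlgHom.coe_toRingHom, hg, hg₀X,
        hvals_cs]
  -- `g` is formally étale
  have hgfe : RingHom.FormallyEtale (R := DiagRing k p) (S := S₁) g.toRingHom := by
    refine RingHom.FormallyEtale.of_comp (formallyUnramified_diagOld k p) ?_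
    rw [hgu]
    exact RingHom.formallyEtale_algebraMap.mpr (Algebra.FormallyEtale.comp B S₀ S₁)
  -- `ψ = g ∘ (k[X] → DiagRing)`
  have hψ : minpolyCoordMap (S₀ := S₀) k t =
      g.toRingHom.comp (algebraMap B (DiagRing k p)) := by
    refine MvPolynomial.ringHom_ext (fun c => ?_) (fun i => ?_)
    · rw [minpolyCoordMap_C, RingHom.comp_apply, AlgHom.toRingHom_eq_coe, AlgHom.coe_toRingHom,
        ← MvPolynomial.algebraMap_eq, ← IsScalarTower.algebraMap_apply, AlgHom.commutes]
    · rw [minpolyCoordMap_X, RingHom.comp_apply, AlgHom.toRingHom_eq_coe, AlgHom.coe_toRingHom]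
      change _ = g (DiagRing.proj k p (MvPolynomial.C (MvPolynomial.X i)))
      rw [hg, hg₀C, hψX]
  have hfe : (minpolyCoordMap (S₀ := S₀) k t).FormallyEtale := by
    rw [hψ]
    exact RingHom.FormallyEtale.comp (RingHom.formallyEtale_algebraMap.mpr inferInstance) hgfe
  -- finite presentation (over `k`, hence over `k[X]`)
  have hfpS₀ : Algebra.FinitePresentation k S₀ := .trans k B S₀
  have hfpS₁S₀ : Algebra.FinitePresentation S₀ S₁ :=
    IsLocalization.Away.finitePresentation (minpolyCoordDen k t)
  have hfpS₁ : Algebra.FinitePresentation k S₁ := .trans k S₀ S₁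
  have hfp : (minpolyCoordMap (S₀ := S₀) k t).FinitePresentation := by
    refine RingHom.FinitePresentation.of_comp_finiteType (algebraMap k B) ?_
      (RingHom.finiteType_algebraMap.mpr inferInstance)
    have : (minpolyCoordMap (S₀ := S₀) k t).comp (algebraMap k B) = algebraMap k S₁ := by
      ext c
      rw [RingHom.comp_apply, MvPolynomial.algebraMap_eq, minpolyCoordMap_C]
    rw [this]
    exact RingHom.finitePresentation_algebraMap.mpr hfpS₁
  exact @Algebra.Etale.mk _ _ _ _ (minpolyCoordMap (S₀ := S₀) k t).toAlgebra hfe hfp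

end Application

end Literature.AlgebraicGeometry.Resolution
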